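import Summits.BirchSwinnertonDyer.Rank1Residual.Iwasawa.LambdaInvariantZerosOrder
import Mathlib.FieldTheory.IsAlgClosed.Basic
import HarnessLib

/-!
# `λ(G)` IS the number of zeros of `G ∈ Λ ∖ {0}` in the open unit disc of `ℂ_p` (with multiplicity);
# Galois orbits of cyclotomic zeros
# (cell `b2b-bsdres`; class-agnostic kernel support for the (μ, λ) censuses of iw-1 / iw-2; prover
# unit `b2b-bsdres-additive-p3`, gen 8)

HONEST FRAMING (run/shared/lean/b2b/bsd-rank1-residual/, verbatim in every file): the goal of the
cell is to DELETE the COMBINATION-SHAPED residual classes of the Birch–Swinnerton-Dyer formula for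
ALL analytic-rank `≤ 1` elliptic curves over `ℚ` — "full BSD formula for every rank `≤ 1` curve in
class `C`" assembled STRICTLY from published theorems — so that the rank-`≤ 1` remainder becomes
exactly the CONSTRUCTION-SHAPED classes, which are TYPED (missing-input `Prop`s), NOT attempted.
This is not "finishing BSD". THEOREMS ONLY (pure `p`-adic algebra); no named fact; nothing about any
curve is asserted; nothing booked; no label changes.

## What this file proves

Gen 7 of this unit (p220367 `LambdaInvariantZeros`, p220754 `LambdaInvariantZerosOrder`) proved the
inequality "one zero of `G ∈ Λ ∖ {0}` at `ζ − 1`, `ζ` of order `pⁿ⁺¹`, costs `φ(pⁿ⁺¹)` of `λ(G)`",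
one layer at a time. The present file proves the structure theorem behind it and the accounting
over all layers simultaneously (Washington, GTM 83, §7.1–7.2: a non-zero element of `Λ` has
exactly `λ` zeros in the open unit disc of `ℂ_p`):

* §1 **Evaluation through the Weierstrass factorisation.** For `G = p^m · G'`, `G' ≢ 0 (mod p)`,
  with distinguished polynomial `P` and unit `U` of `G'` (Mathlib's Weierstrass preparation), and
  `|z| < 1`: `G(z) = 0 ↔ P(z) = 0` (`hasSum_zero_iff_eval₂_weierstrassDistinguished_eq_zero`).
* §2 **All roots of a distinguished polynomial lie in the open unit disc**
  (`norm_lt_one_of_eval₂_eq_zero_of_isDistinguishedAt`: `P = X^d + (terms with coefficients in pℤ_p)`,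
  so `|z| ≥ 1` gives `|P(z)| = |z|^d ≠ 0` by the ultrametric inequality).
* §3 **The zero-count theorem.** The multiset `Z = roots of P in ℂ_p` satisfies
  `z ∈ Z ↔ |z| < 1 ∧ G(z) = 0` (`mem_roots_weierstrassDistinguished_iff`) and `card Z = λ(G)`
  (`card_roots_weierstrassDistinguished_eq_lam`; `ℂ_p` is algebraically closed, `deg P = λ(G)`).
  Hence any finite set of DISTINCT zeros of `G` in the open disc has at most `λ(G)` elements
  (`card_le_lam_of_forall_hasSum_zero`).
* §4 **Galois orbits.** `G(ζ − 1) = 0 ↔ G(ζ' − 1) = 0` for any two primitive `pⁿ⁺¹`-th roots of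
  unity `ζ, ζ'` (`hasSum_zero_iff_of_isPrimitiveRoot`: both say `Φ_{pⁿ⁺¹}(X+1) ∣ P` in `ℚ_p[X]`,
  the common minimal polynomial, p220367); so a vanishing layer contributes a full orbit of
  `φ(pⁿ⁺¹)` distinct zeros.
The accounting over all vanishing layers at once (`r + Σ_{n ∈ S} φ(pⁿ⁺¹) ≤ λ(G)`, hence at most
`log_p(λ(G) − r + 1)` vanishing layers) and the arithmetic consumers (twisted `L`-values) are in the
sibling file `Iwasawa/LambdaInvariantZeroSetLayers.lean`.

References: [Washington1997] §7.1–7.2 (Prop. 7.2, Thm. 7.3, Cor. 7.4); [Lang1990] Ch. 5 §2 Thm. 2.2;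
HOME/b2b-bsdres-additive-p3/X8-ROUTE-B.md §13 (gen 8).
-/

set_option autoImplicit false

noncomputable section

open scoped Classical

open Polynomial Literature.NumberTheory.EllipticCurves
  Summit.BirchSwinnertonDyer.Rank1Residual.X1.MuLambda

namespace Summit.BirchSwinnertonDyer.Rank1Residual.Iwasawa

variable {p : ℕ} [hp : Fact p.Prime]

/-! ## §1. Evaluation through the Weierstrass factorisation -/

section Eval

/-- `ιℂ : ℤ_p → ℂ_p` is injective. [folklore] -/
theorem injective_algebraMap_comp :
    Function.Injective ((algebraMap ℚ_[p] ℂ_[p]).comp (algebraMap ℤ_[p] ℚ_[p])) :=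
  (algebraMap ℚ_[p] ℂ_[p]).injective.comp (IsFractionRing.injective ℤ_[p] ℚ_[p])

/-- `‖ιℂ a‖ = ‖a‖` for `a ∈ ℤ_p`. [folklore] -/
theorem norm_algebraMap_comp_apply (a : ℤ_[p]) :
    ‖((algebraMap ℚ_[p] ℂ_[p]).comp (algebraMap ℤ_[p] ℚ_[p])) a‖ = ‖a‖ := by
  rw [RingHom.comp_apply, norm_algebraMap', PadicInt.algebraMap_apply, PadicInt.padic_norm_e_of_padicInt]

/-- **Evaluation factorises through Weierstrass preparation.** If `G = p^m · G'` in `Λ` with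
`G' ≢ 0 (mod p)`, `P` the distinguished polynomial and `U` the unit of `G'`, then for `|z| < 1`
`∑ G_k z^k = ιℂ(p^m) · P(z) · U(z)` with `U(z) ≠ 0`; hence `G(z) = 0 ↔ P(z) = 0`.
[cite: Washington1997, §7.1–7.2 and Thm. 7.3] -/
theorem hasSum_zero_iff_eval₂_weierstrassDistinguished_eq_zero {G G' : IwasawaAlgebra p} {m : ℕ}
    (hGG' : G = PowerSeries.C ((p : ℤ_[p]) ^ m) * G')
    (hG' : G'.map (IsLocalRing.residue ℤ_[p]) ≠ 0) {z : ℂ_[p]} (hz : ‖z‖ < 1) :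
    HasSum (fun k ↦ ((algebraMap ℚ_[p] ℂ_[p]).comp (algebraMap ℤ_[p] ℚ_[p]))
        (PowerSeries.coeff k G) * z ^ k) 0 ↔
      (G'.weierstrassDistinguished hG').eval₂
        ((algebraMap ℚ_[p] ℂ_[p]).comp (algebraMap ℤ_[p] ℚ_[p])) z = 0 := by
  set ιZ : ℤ_[p] →+* ℂ_[p] := (algebraMap ℚ_[p] ℂ_[p]).comp (algebraMap ℤ_[p] ℚ_[p]) with hιZ
  have hbd : ∀ (A : PowerSeries ℤ_[p]) (k : ℕ), ‖ιZ (PowerSeries.coeff k A)‖ ≤ 1 :=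
    norm_algebraMap_coeff_le_one
  set P : Polynomial ℤ_[p] := G'.weierstrassDistinguished hG' with hP
  set U : PowerSeries ℤ_[p] := G'.weierstrassUnit hG' with hU
  have hfac : G' = (P : PowerSeries ℤ_[p]) * U :=
    G'.eq_weierstrassDistinguished_mul_weierstrassUnit hG'
  obtain ⟨V, hUV⟩ := (G'.isUnit_weierstrassUnit hG').exists_right_inv
  -- `G(z) = p^m P(z) U(z)` and `U(z) V(z) = 1`
  have hGeval : ∑' k, ιZ (PowerSeries.coeff k G) * z ^ k =
      ιZ ((p : ℤ_[p]) ^ m) * (P.eval₂ ιZ z * ∑' k, ιZ (PowerSeries.coeff k U) * z ^ k) := by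
    rw [hGG', tsum_map_coeff_mul_mul_pow ιZ (hbd _) (hbd _) hz,
      (hasSum_map_coeff_C_mul_pow ιZ _ z).tsum_eq, hfac,
      tsum_map_coeff_mul_mul_pow ιZ (hbd _) (hbd _) hz,
      (hasSum_map_coeff_coe_mul_pow ιZ P z).tsum_eq]
  have hUV' : (∑' k, ιZ (PowerSeries.coeff k U) * z ^ k) *
      ∑' k, ιZ (PowerSeries.coeff k V) * z ^ k = 1 := by
    rw [← tsum_map_coeff_mul_mul_pow ιZ (hbd _) (hbd _) hz, hUV,
      (hasSum_map_coeff_one_mul_pow ιZ z).tsum_eq]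
  have hUne : ∑' k, ιZ (PowerSeries.coeff k U) * z ^ k ≠ 0 := left_ne_zero_of_mul_eq_one hUV'
  have hpm : ιZ ((p : ℤ_[p]) ^ m) ≠ 0 := by
    rw [map_pow, map_natCast]
    exact pow_ne_zero _ (Nat.cast_ne_zero.mpr hp.out.ne_zero)
  have hsummable := summable_map_coeff_mul_pow ιZ (hbd G) hz
  constructor
  · intro hsum
    rw [hsum.tsum_eq] at hGeval
    have h1 := (mul_eq_zero.mp hGeval.symm).resolve_left hpm
    exact (mul_eq_zero.mp h1).resolve_right hUne
  · intro hP0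
    rw [hP0, zero_mul, mul_zero] at hGeval
    rw [← hGeval]
    exact hsummable.hasSum

/-- `T^r · G₀` vanishes at `z ≠ 0`, `|z| < 1`, iff `G₀` does (evaluation is multiplicative and
`z^r ≠ 0`). [cite: Washington1997, §7.1] -/
theorem hasSum_zero_X_pow_mul_iff {G₀ : IwasawaAlgebra p} (r : ℕ) {z : ℂ_[p]} (hz : ‖z‖ < 1)
    (hz0 : z ≠ 0) :
    HasSum (fun k ↦ ((algebraMap ℚ_[p] ℂ_[p]).comp (algebraMap ℤ_[p] ℚ_[p]))
        (PowerSeries.coeff k ((PowerSeries.X : IwasawaAlgebra p) ^ r * G₀)) * z ^ k) 0 ↔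
      HasSum (fun k ↦ ((algebraMap ℚ_[p] ℂ_[p]).comp (algebraMap ℤ_[p] ℚ_[p]))
        (PowerSeries.coeff k G₀) * z ^ k) 0 := by
  set ιZ : ℤ_[p] →+* ℂ_[p] := (algebraMap ℚ_[p] ℂ_[p]).comp (algebraMap ℤ_[p] ℚ_[p]) with hιZ
  have hbd : ∀ (A : PowerSeries ℤ_[p]) (k : ℕ), ‖ιZ (PowerSeries.coeff k A)‖ ≤ 1 :=
    norm_algebraMap_coeff_le_one
  -- `(T^r G₀)(z) = z^r · G₀(z)`
  have heval : ∑' k, ιZ (PowerSeries.coeff k ((PowerSeries.X : IwasawaAlgebra p) ^ r * G₀)) *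
      z ^ k = z ^ r * ∑' k, ιZ (PowerSeries.coeff k G₀) * z ^ k := by
    rw [tsum_map_coeff_mul_mul_pow ιZ (hbd _) (hbd _) hz,
      show ((PowerSeries.X : IwasawaAlgebra p) ^ r) = ((X ^ r : ℤ_[p][X]) : PowerSeries ℤ_[p]) by
        rw [Polynomial.coe_pow, Polynomial.coe_X],
      (hasSum_map_coeff_coe_mul_pow ιZ (X ^ r : ℤ_[p][X]) z).tsum_eq, eval₂_pow, eval₂_X]
  have hs₁ := summable_map_coeff_mul_pow ιZ (hbd ((PowerSeries.X : IwasawaAlgebra p) ^ r * G₀)) hz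
  have hs₀ := summable_map_coeff_mul_pow ιZ (hbd G₀) hz
  constructor
  · intro h
    rw [h.tsum_eq] at heval
    have h0 : ∑' k, ιZ (PowerSeries.coeff k G₀) * z ^ k = 0 :=
      (mul_eq_zero.mp heval.symm).resolve_left (pow_ne_zero _ hz0)
    rw [← h0]
    exact hs₀.hasSum
  · intro h
    rw [h.tsum_eq, mul_zero] at heval
    rw [← heval]
    exact hs₁.hasSum

end Eval

/-! ## §2. The roots of a distinguished polynomial lie in the open unit disc -/

section Distinguished

/-- **Every root in `ℂ_p` of a distinguished polynomial `P ∈ ℤ_p[X]` has `|z| < 1`**: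
`P = X^d + a_{d−1}X^{d−1} + ⋯ + a_0` with `a_i ∈ pℤ_p`, so for `|z| ≥ 1` every lower term has
`|a_i z^i| < |z|^d` and the ultrametric inequality gives `|P(z)| = |z|^d ≠ 0`.
[cite: Washington1997, §7.1 (distinguished polynomials) and Prop. 7.2] -/
theorem norm_lt_one_of_eval₂_eq_zero_of_isDistinguishedAt {P : ℤ_[p][X]}
    (hP : P.IsDistinguishedAt (IsLocalRing.maximalIdeal ℤ_[p])) {z : ℂ_[p]}
    (hroot : P.eval₂ ((algebraMap ℚ_[p] ℂ_[p]).comp (algebraMap ℤ_[p] ℚ_[p])) z = 0) :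
    ‖z‖ < 1 := by
  set ιZ : ℤ_[p] →+* ℂ_[p] := (algebraMap ℚ_[p] ℂ_[p]).comp (algebraMap ℤ_[p] ℚ_[p]) with hιZ
  by_contra hge
  rw [not_lt] at hge
  set d := P.natDegree with hd
  have hmonic : P.Monic := hP.monic
  -- `d = 0`: `P = 1` has no root
  rcases Nat.eq_zero_or_pos d with hd0 | hdpos
  · have hd0' : P.natDegree = 0 := by rw [← hd]; exact hd0
    have hP1 : P = 1 := Polynomial.eq_one_of_monic_natDegree_zero hmonic hd0'
    rw [hP1, eval₂_one] at hroot
    exact one_ne_zero hroot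
  -- `P(z) = z^d + s`, `s = Σ_{i<d} a_i z^i`
  have hsplit : P.eval₂ ιZ z = (∑ i ∈ Finset.range d, ιZ (P.coeff i) * z ^ i) + z ^ d := by
    rw [eval₂_eq_sum_range, Finset.sum_range_succ, ← hd]
    congr 1
    rw [show P.coeff d = 1 from hmonic.coeff_natDegree ▸ (by rw [hd]), map_one, one_mul]
  have hz0 : 0 < ‖z‖ := lt_of_lt_of_le one_pos hge
  -- every lower term is `< ‖z‖^d`
  have hterm : ∀ i ∈ Finset.range d, ‖ιZ (P.coeff i) * z ^ i‖ < ‖z‖ ^ d := by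
    intro i hi
    rw [Finset.mem_range] at hi
    have hmem : P.coeff i ∈ IsLocalRing.maximalIdeal ℤ_[p] := hP.mem (by rw [← hd]; exact hi)
    have hai : ‖ιZ (P.coeff i)‖ < 1 := by
      rw [hιZ, norm_algebraMap_comp_apply]
      exact PadicInt.mem_nonunits.mp (IsLocalRing.mem_maximalIdeal _ |>.mp hmem)
    rw [norm_mul, norm_pow]
    calc ‖ιZ (P.coeff i)‖ * ‖z‖ ^ i < 1 * ‖z‖ ^ i :=
          mul_lt_mul_of_pos_right hai (pow_pos hz0 i)
      _ = ‖z‖ ^ i := one_mul _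
      _ ≤ ‖z‖ ^ d := pow_le_pow_right₀ hge hi.le
  have hne : (Finset.range d).Nonempty := ⟨0, Finset.mem_range.mpr hdpos⟩
  obtain ⟨i, hi, hle⟩ := IsUltrametricDist.exists_norm_finsetSum_le_of_nonempty hne
    (fun i ↦ ιZ (P.coeff i) * z ^ i)
  have hs : ‖∑ i ∈ Finset.range d, ιZ (P.coeff i) * z ^ i‖ < ‖z ^ d‖ := by
    rw [norm_pow]
    exact lt_of_le_of_lt hle (hterm i hi)
  have hnorm : ‖P.eval₂ ιZ z‖ = ‖z ^ d‖ := by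
    rw [hsplit, IsUltrametricDist.norm_add_eq_max_of_norm_ne_norm hs.ne, max_eq_right hs.le]
  rw [hroot, norm_zero, norm_pow] at hnorm
  exact (pow_pos hz0 d).ne' hnorm.symm

end Distinguished

/-! ## §3. The zero-count theorem: `card (zeros of G in the open disc) = λ(G)` -/

section Count

/-- **`deg P = λ(G)` transported to `ℂ_p`: the roots of `P` in `ℂ_p`, with multiplicity, number
`λ(G)`** (`ℂ_p` is algebraically closed, so the base change of `P` splits; `deg P = λ(G)` is
p220367's `lam_eq_natDegree_weierstrassDistinguished`).
[cite: Washington1997, §7.1–7.2 and Thm. 7.3] -/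
theorem card_roots_weierstrassDistinguished_eq_lam {G G' : IwasawaAlgebra p} {m : ℕ}
    (hGG' : G = PowerSeries.C ((p : ℤ_[p]) ^ m) * G')
    (hG' : G'.map (IsLocalRing.residue ℤ_[p]) ≠ 0) :
    Multiset.card ((G'.weierstrassDistinguished hG').map
        ((algebraMap ℚ_[p] ℂ_[p]).comp (algebraMap ℤ_[p] ℚ_[p]))).roots = lam G := by
  rw [lam_eq_natDegree_weierstrassDistinguished hGG' hG',
    ← natDegree_map_eq_of_injective injective_algebraMap_comp (G'.weierstrassDistinguished hG'),
    (IsAlgClosed.splits _).natDegree_eq_card_roots]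

/-- **The zeros of `G` in the open unit disc are exactly the roots of its distinguished
polynomial**: for `G = p^m · G'`, `G' ≢ 0 (mod p)`, `P` the distinguished polynomial of `G'`, and
any `z ∈ ℂ_p`: `z` is a root of `P` iff `|z| < 1` and `∑ G_k z^k = 0`.
[cite: Washington1997, §7.1–7.2, Prop. 7.2 and Thm. 7.3] -/
theorem mem_roots_weierstrassDistinguished_iff {G G' : IwasawaAlgebra p} {m : ℕ}
    (hGG' : G = PowerSeries.C ((p : ℤ_[p]) ^ m) * G')
    (hG' : G'.map (IsLocalRing.residue ℤ_[p]) ≠ 0) (z : ℂ_[p]) :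
    z ∈ ((G'.weierstrassDistinguished hG').map
        ((algebraMap ℚ_[p] ℂ_[p]).comp (algebraMap ℤ_[p] ℚ_[p]))).roots ↔
      ‖z‖ < 1 ∧ HasSum (fun k ↦ ((algebraMap ℚ_[p] ℂ_[p]).comp (algebraMap ℤ_[p] ℚ_[p]))
        (PowerSeries.coeff k G) * z ^ k) 0 := by
  set ιZ : ℤ_[p] →+* ℂ_[p] := (algebraMap ℚ_[p] ℂ_[p]).comp (algebraMap ℤ_[p] ℚ_[p]) with hιZ
  set P : Polynomial ℤ_[p] := G'.weierstrassDistinguished hG' with hP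
  have hdist : P.IsDistinguishedAt (IsLocalRing.maximalIdeal ℤ_[p]) :=
    G'.isDistinguishedAt_weierstrassDistinguished hG'
  have hPne : P.map ιZ ≠ 0 := (hdist.monic.map ιZ).ne_zero
  rw [mem_roots hPne, IsRoot.def, eval_map]
  constructor
  · intro hroot
    have hz : ‖z‖ < 1 := norm_lt_one_of_eval₂_eq_zero_of_isDistinguishedAt hdist hroot
    exact ⟨hz, (hasSum_zero_iff_eval₂_weierstrassDistinguished_eq_zero hGG' hG' hz).mpr hroot⟩
  · rintro ⟨hz, hsum⟩
    exact (hasSum_zero_iff_eval₂_weierstrassDistinguished_eq_zero hGG' hG' hz).mp hsum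

/-- **A finite set of distinct zeros of `G ≠ 0` in the open unit disc of `ℂ_p` has at most `λ(G)`
elements** (it injects into the roots of the distinguished polynomial, which number `λ(G)` with
multiplicity). No hypothesis on `μ(G)`. [cite: Washington1997, §7.1–7.2 and Thm. 7.3] -/
theorem card_le_lam_of_forall_hasSum_zero {G : IwasawaAlgebra p} (hG0 : G ≠ 0) (Z : Finset ℂ_[p])
    (hZ : ∀ z ∈ Z, ‖z‖ < 1 ∧ HasSum (fun k ↦ ((algebraMap ℚ_[p] ℂ_[p]).comp
      (algebraMap ℤ_[p] ℚ_[p])) (PowerSeries.coeff k G) * z ^ k) 0) :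
    Z.card ≤ lam G := by
  obtain ⟨m, G', hGG', hG'⟩ := IwasawaAlgebra.exists_eq_C_pow_mul_and_map_residue_ne_zero p hG0
  set R := ((G'.weierstrassDistinguished hG').map
    ((algebraMap ℚ_[p] ℂ_[p]).comp (algebraMap ℤ_[p] ℚ_[p]))).roots with hR
  have hsub : Z ⊆ R.toFinset := by
    intro z hz
    rw [Multiset.mem_toFinset]
    exact (mem_roots_weierstrassDistinguished_iff hGG' hG' z).mpr (hZ z hz)
  calc Z.card ≤ R.toFinset.card := Finset.card_le_card hsub
    _ ≤ Multiset.card R := Multiset.toFinset_card_le R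
    _ = lam G := card_roots_weierstrassDistinguished_eq_lam hGG' hG'

/-- **`λ(G) = 0`, `G ≠ 0` ⇒ `G` has NO zero in the open unit disc** (`G = p^μ · unit`). In
particular a `p`-adic `L`-function with `λ = 0` vanishes at no `ζ − 1`, `ζ ∈ μ_{p^∞}`, and not at
`T = 0`. [cite: Washington1997, §7.1–7.2 and Thm. 7.3] -/
theorem not_hasSum_zero_of_lam_eq_zero {G : IwasawaAlgebra p} (hG0 : G ≠ 0) (hlam : lam G = 0)
    {z : ℂ_[p]} (hz : ‖z‖ < 1) :
    ¬ HasSum (fun k ↦ ((algebraMap ℚ_[p] ℂ_[p]).comp (algebraMap ℤ_[p] ℚ_[p]))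
        (PowerSeries.coeff k G) * z ^ k) 0 := by
  intro hsum
  have h := card_le_lam_of_forall_hasSum_zero hG0 {z} (fun w hw ↦ by
    rw [Finset.mem_singleton] at hw; subst hw; exact ⟨hz, hsum⟩)
  rw [Finset.card_singleton, hlam] at h
  exact Nat.not_succ_le_zero 0 h

end Count

/-! ## §4. Galois orbits: vanishing at `ζ − 1` depends only on the order of `ζ` -/

section Orbit

/-- `P(ζ − 1) = 0 ↔ Φ_{pⁿ⁺¹}(X + 1) ∣ P` in `ℚ_p[X]`, for `P ∈ ℤ_p[X]` and `ζ ∈ ℂ_p` of order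
`pⁿ⁺¹` (`Φ_{pⁿ⁺¹}(X+1)` is the minimal polynomial of `ζ − 1` over `ℚ_p`, p220367). [folklore] -/
theorem eval₂_eq_zero_iff_cyclotomic_comp_dvd {n : ℕ} {ζ : ℂ_[p]}
    (hζ : IsPrimitiveRoot ζ (p ^ (n + 1))) (P : ℤ_[p][X]) :
    P.eval₂ ((algebraMap ℚ_[p] ℂ_[p]).comp (algebraMap ℤ_[p] ℚ_[p])) (ζ - 1) = 0 ↔
      (cyclotomic (p ^ (n + 1)) ℚ_[p]).comp (X + 1) ∣ P.map (algebraMap ℤ_[p] ℚ_[p]) := by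
  have haeval : aeval (ζ - 1) (P.map (algebraMap ℤ_[p] ℚ_[p])) =
      P.eval₂ ((algebraMap ℚ_[p] ℂ_[p]).comp (algebraMap ℤ_[p] ℚ_[p])) (ζ - 1) := by
    rw [aeval_def, eval₂_map]
  rw [← minpoly_sub_one_eq_cyclotomic_comp hζ, ← haeval]
  constructor
  · exact minpoly.dvd ℚ_[p] (ζ - 1)
  · rintro ⟨Q, hQ⟩
    rw [hQ, map_mul, minpoly.aeval, zero_mul]

/-- **Vanishing at `ζ − 1` is a property of the LAYER, not of `ζ`**: for `G ∈ Λ` and two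
primitive `pⁿ⁺¹`-th roots of unity `ζ, ζ' ∈ ℂ_p`, `G(ζ − 1) = 0 ↔ G(ζ' − 1) = 0` (the coefficients
of `G` lie in `ℤ_p` and `ζ − 1`, `ζ' − 1` are conjugate over `ℚ_p`: both conditions say
`Φ_{pⁿ⁺¹}(X+1)` divides the distinguished polynomial of `G`). So a vanishing layer contributes the
full orbit of `φ(pⁿ⁺¹)` distinct zeros. [cite: Washington1997, §7.1–7.2 and Thm. 7.3] -/
theorem hasSum_zero_iff_of_isPrimitiveRoot (G : IwasawaAlgebra p) {n : ℕ} {ζ ζ' : ℂ_[p]}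
    (hζ : IsPrimitiveRoot ζ (p ^ (n + 1))) (hζ' : IsPrimitiveRoot ζ' (p ^ (n + 1))) :
    HasSum (fun k ↦ ((algebraMap ℚ_[p] ℂ_[p]).comp (algebraMap ℤ_[p] ℚ_[p]))
        (PowerSeries.coeff k G) * (ζ - 1) ^ k) 0 ↔
      HasSum (fun k ↦ ((algebraMap ℚ_[p] ℂ_[p]).comp (algebraMap ℤ_[p] ℚ_[p]))
        (PowerSeries.coeff k G) * (ζ' - 1) ^ k) 0 := by
  by_cases hG0 : G = 0
  · subst hG0
    simp only [map_zero, zero_mul]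
  obtain ⟨m, G', hGG', hG'⟩ := IwasawaAlgebra.exists_eq_C_pow_mul_and_map_residue_ne_zero p hG0
  have hz : ‖ζ - 1‖ < 1 := norm_sub_one_lt_one_of_pow_prime_pow_eq_one (j := n + 1) hζ.pow_eq_one
  have hz' : ‖ζ' - 1‖ < 1 :=
    norm_sub_one_lt_one_of_pow_prime_pow_eq_one (j := n + 1) hζ'.pow_eq_one
  rw [hasSum_zero_iff_eval₂_weierstrassDistinguished_eq_zero hGG' hG' hz,
    hasSum_zero_iff_eval₂_weierstrassDistinguished_eq_zero hGG' hG' hz',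
    eval₂_eq_zero_iff_cyclotomic_comp_dvd hζ, eval₂_eq_zero_iff_cyclotomic_comp_dvd hζ']

end Orbit


end Summit.BirchSwinnertonDyer.Rank1Residual.Iwasawa

end
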